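import Literature.Analysis.FluidPDE.DriftHeatLocalClass
import Mathlib.Analysis.Calculus.BumpFunction.InnerProduct
import HarnessLib

/-!
# The comparison principle for the local drift–heat class

Analysis/FluidPDE proofs file (theorems only), second layer of the proof of the named fact
`Literature.Analysis.FluidPDE.KNSS2009_lemma21` (KNSS 2009, Lemma 2.1 as printed, on a bounded
domain). For the local time-integrated class `IsDriftHeatSolutionOn a g A S U` of
`DriftHeatLocalClass` (`C²` slices on an open `U`, `∇g`, `Δg` jointly continuous on `S × U`,
`g(t) − g(s) = ∫ₛᵗ (Δg − Dg[a])` with a bounded measurable drift) it proves: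

* `laplacian_nonpos_of_isLocalMax_of_contDiffOn`: the second-order condition `Δ W(x) ≤ 0` at an
  interior local maximum of a function that is `C²` only on an open set (localisation of
  `IsLocalMax.laplacian_nonpos` of `ParabolicComparison` by a bump function: `χ W` is globally
  `C²`, agrees with `W` near the point, so has the same Laplacian and the same local maximum);
* `IsDriftHeatSolutionOn.paraboloid_comparison`: the **comparison principle on an expanding
  paraboloid** `K = {(t, x) : t_b ≤ t ≤ t_T, ‖x − c‖² ≤ P(t)} ⊆ [t_b, t_T] × U` — a classical
  barrier `φ` with `φₜ ≤ Δφ − A‖∇φ‖` inside `K` (hence `φₜ ≤ Δφ − Dφ[a]` for *every* drift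
  `‖a‖ ≤ A`), lying below `g` on the bottom and on the side of `K`, lies below `g` on `K`. This is
  Lieberman 1996, Ch. II, Corollary 2.5 (with Lemma 2.1/2.3), and the proof is the one of
  `ParabolicComparison.paraboloid_comparison` (whole-space class) verbatim: a positive maximum
  of `φ − g − θ(t − t_b)` on the compact `K` lies off the parabolic boundary; there `Dφ = Dg`,
  `Δφ ≤ Δg`, and the integrated equation on a short interval below the maximal time, with the
  integrand controlled by the joint continuity of `∇g`, `Δg` (the drift is only measurable),
  contradicts maximality; then `θ → 0`.

## References

* G. M. Lieberman, *Second Order Parabolic Differential Equations*, World Scientific (1996),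
  Ch. II §1, Lemma 2.1, Lemma 2.3, Corollary 2.5 (pp. 7–10). [Lieberman1996]
* G. Koch, N. Nadirashvili, G. Seregin, V. Šverák, *Liouville theorems for the Navier–Stokes
  equations and applications*, Acta Math. 203 (2009) = arXiv:0709.3599, Lemma 2.1 (p. 5).
  [KochNadirashviliSereginSverak2009]
-/

noncomputable section

open MeasureTheory Set Function Filter TopologicalSpace InnerProductSpace Metric
open scoped RealInnerProductSpace Laplacian ContDiff Topology

namespace Literature.Analysis.FluidPDE

variable {E : Type*} [NormedAddCommGroup E] [InnerProductSpace ℝ E] [FiniteDimensional ℝ E]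
  [MeasurableSpace E]

/-! ### Second-order condition at a local maximum, for functions `C²` on an open set -/

omit [MeasurableSpace E] in
/-- **At an interior local maximum of a function `C²` on an open set, the Laplacian is
nonpositive** (localisation of `IsLocalMax.laplacian_nonpos` by a bump function: `χ W` is
globally `C²`, agrees with `W` near the point, so has the same Laplacian there and the same local
maximum). [cite: Lieberman1996, Ch. II Lemma 2.1 (proof; second-order condition)] -/
theorem laplacian_nonpos_of_isLocalMax_of_contDiffOn {W : E → ℝ} {x : E} {V : Set E}
    (hV : IsOpen V) (hx : x ∈ V) (hW : ContDiffOn ℝ 2 W V) (h : IsLocalMax W x) :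
    (Δ W) x ≤ 0 := by
  obtain ⟨r, hr, hrV⟩ := Metric.isOpen_iff.1 hV x hx
  let χ : ContDiffBump x := ⟨r / 4, r / 2, by positivity, by linarith⟩
  set W' : E → ℝ := fun y => χ y * W y with hW'
  have hC : ContDiff ℝ 2 W' := by
    rw [contDiff_iff_contDiffAt]
    intro y
    by_cases hy : y ∈ ball x r
    · exact χ.contDiff.contDiffAt.mul (hW.contDiffAt (hV.mem_nhds (hrV hy)))
    · have hzero : W' =ᶠ[𝓝 y] fun _ => 0 := by
        have hopen : IsOpen {z : E | r / 2 < dist z x} :=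
          isOpen_lt continuous_const (continuous_id.dist continuous_const)
        have hyr : r / 2 < dist y x := by
          have : r ≤ dist y x := by
            by_contra hcon
            exact hy (mem_ball.2 (lt_of_not_ge hcon))
          linarith
        filter_upwards [hopen.mem_nhds hyr] with z hz
        have hz0 : χ z = 0 := χ.zero_of_le_dist (le_of_lt hz)
        simp [hW', hz0]
      exact contDiffAt_const.congr_of_eventuallyEq hzero
  have heq : W' =ᶠ[𝓝 x] W := by
    filter_upwards [χ.eventuallyEq_one] with y hy
    simp [hW', hy]
  have hmax : IsLocalMax W' x := by
    have h1 : W' x = W x := heq.self_of_nhds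
    filter_upwards [h, heq] with y hy hy'
    rw [hy', h1]
    exact hy
  rw [← (laplacian_congr_nhds heq).self_of_nhds]
  exact IsLocalMax.laplacian_nonpos hC hmax

/-! ### The comparison principle for the local class -/

namespace IsDriftHeatSolutionOn

variable {a : ℝ → E → E} {g : ℝ → E → ℝ} {A : ℝ} {S : Set ℝ} {U : Set E}

/-- **Comparison principle on an expanding paraboloid, local time-integrated class**
(Lieberman 1996, Ch. II, Corollary 2.5 with Lemma 2.1/2.3; the statement and proof of
`ParabolicComparison.paraboloid_comparison` with the supersolution `g` in the local class
`IsDriftHeatSolutionOn a g A S U`, `U` open, `[t_b, t_T] ⊆ S`, and the region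
`K = {(t, x) : t ∈ [t_b, t_T], ‖x − c‖² ≤ P(t)}` contained in `[t_b, t_T] × U`). The barrier `φ`
is classical: continuous on `[t_b, t_T] × E`, `C²` slices, a time derivative `φₜ` with `φₜ`,
`∇φ`, `Δφ` continuous in `t` at each `x`, and `φₜ ≤ Δφ − A‖∇φ‖` inside `K` (so
`φₜ ≤ Δφ − Dφ[a]` for every drift `‖a‖ ≤ A`). If `φ ≤ g` on the bottom `{t = t_b}` and on the
side `{‖x − c‖² = P(t)}` of `K`, then `φ ≤ g` on `K`. [cite: Lieberman1996, Ch. II Cor. 2.5 with Lemma 2.1, Lemma 2.3 (pp. 7–10)] -/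
theorem paraboloid_comparison [BorelSpace E] (hg : IsDriftHeatSolutionOn a g A S U)
    (hU : IsOpen U) {c : E} {t_b t_T : ℝ} (hS : Icc t_b t_T ⊆ S) {P : ℝ → ℝ}
    (hPc : Continuous P)
    (hPU : ∀ t ∈ Icc t_b t_T, ∀ x, ‖x - c‖ ^ 2 ≤ P t → x ∈ U) {φ φt : ℝ → E → ℝ}
    (hφ_c : ContinuousOn (uncurry φ) (Icc t_b t_T ×ˢ univ))
    (hφ2 : ∀ t ∈ Icc t_b t_T, ContDiff ℝ 2 (φ t))
    (hφt : ∀ x, ∀ t ∈ Icc t_b t_T, HasDerivAt (fun τ => φ τ x) (φt t x) t)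
    (hφt_c : ∀ x, ContinuousOn (fun τ => φt τ x) (Icc t_b t_T))
    (hφD_c : ∀ x, ContinuousOn (fun τ => fderiv ℝ (φ τ) x) (Icc t_b t_T))
    (hφΔ_c : ∀ x, ContinuousOn (fun τ => (Δ (φ τ)) x) (Icc t_b t_T))
    (hφ_ineq : ∀ t ∈ Ioc t_b t_T, ∀ x, ‖x - c‖ ^ 2 < P t →
      φt t x ≤ (Δ (φ t)) x - A * ‖fderiv ℝ (φ t) x‖)
    (hbot : ∀ x, ‖x - c‖ ^ 2 ≤ P t_b → φ t_b x ≤ g t_b x)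
    (hside : ∀ t ∈ Icc t_b t_T, ∀ x, ‖x - c‖ ^ 2 = P t → φ t x ≤ g t x) :
    ∀ t ∈ Icc t_b t_T, ∀ x, ‖x - c‖ ^ 2 ≤ P t → φ t x ≤ g t x := by
  -- the compact region `K`
  set K : Set (ℝ × E) := {p | p.1 ∈ Icc t_b t_T ∧ ‖p.2 - c‖ ^ 2 ≤ P p.1} with hK
  obtain ⟨MP, hMP⟩ : ∃ MP : ℝ, ∀ t ∈ Icc t_b t_T, P t ≤ MP := by
    obtain ⟨MP, hMP⟩ := (isCompact_Icc (a := t_b) (b := t_T)).bddAbove_image hPc.continuousOn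
    exact ⟨MP, fun t ht => hMP ⟨t, ht, rfl⟩⟩
  have hKsub : K ⊆ Icc t_b t_T ×ˢ closedBall c (Real.sqrt (max MP 0)) := by
    rintro ⟨t, x⟩ ⟨ht, hx⟩
    refine ⟨ht, ?_⟩
    rw [mem_closedBall, dist_eq_norm]
    have h1 : ‖x - c‖ ^ 2 ≤ max MP 0 := (hx.trans (hMP t ht)).trans (le_max_left _ _)
    calc ‖x - c‖ = Real.sqrt (‖x - c‖ ^ 2) := (Real.sqrt_sq (norm_nonneg _)).symm
      _ ≤ Real.sqrt (max MP 0) := Real.sqrt_le_sqrt h1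
  have hKclosed : IsClosed K := by
    refine (isClosed_Icc.preimage continuous_fst).inter ?_
    exact isClosed_le ((continuous_snd.sub continuous_const).norm.pow 2) (hPc.comp continuous_fst)
  have hKc : IsCompact K :=
    (isCompact_Icc.prod (isCompact_closedBall _ _)).of_isClosed_subset hKclosed hKsub
  have hKmem : ∀ {t : ℝ} {x : E}, t ∈ Icc t_b t_T → ‖x - c‖ ^ 2 ≤ P t → (t, x) ∈ K :=
    fun ht hx => ⟨ht, hx⟩
  have hKU : K ⊆ Icc t_b t_T ×ˢ U := by
    rintro ⟨t, x⟩ ⟨ht, hx⟩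
    exact ⟨ht, hPU t ht x hx⟩
  -- continuity of `g` on `K`
  have hg_c : ContinuousOn (uncurry g) (Icc t_b t_T ×ˢ U) := hg.continuousOn_uncurry hU hS
  -- the claim for every `θ > 0`
  have main : ∀ θ : ℝ, 0 < θ → ∀ p ∈ K, φ p.1 p.2 - g p.1 p.2 - θ * (p.1 - t_b) ≤ 0 := by
    intro θ hθ
    set w : ℝ × E → ℝ := fun p => φ p.1 p.2 - g p.1 p.2 - θ * (p.1 - t_b) with hw
    have hKsub' : K ⊆ Icc t_b t_T ×ˢ univ := by
      rintro ⟨t, x⟩ ⟨ht, -⟩; exact ⟨ht, mem_univ _⟩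
    have hwc : ContinuousOn w K := by
      refine (((hφ_c.mono hKsub').sub (hg_c.mono hKU)).sub ?_)
      exact (continuous_const.mul (continuous_fst.sub continuous_const)).continuousOn
    by_contra hcon
    push Not at hcon
    obtain ⟨p₁, hp₁K, hp₁⟩ := hcon
    obtain ⟨X, hXK, hXmax⟩ := hKc.exists_isMaxOn ⟨p₁, hp₁K⟩ hwc
    have hXpos : 0 < w X := hp₁.trans_le (hXmax hp₁K)
    obtain ⟨ts, xs⟩ := X
    obtain ⟨htsI, hxs⟩ := hXK
    have hxsU : xs ∈ U := hPU ts htsI xs hxs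
    -- not on the bottom
    have hts_ne : ts ≠ t_b := by
      intro h
      subst h
      have := hbot xs hxs
      simp [hw] at hXpos
      linarith
    have hts_gt : t_b < ts := lt_of_le_of_ne htsI.1 (Ne.symm hts_ne)
    have htsIoc : ts ∈ Ioc t_b t_T := ⟨hts_gt, htsI.2⟩
    have htsS : ts ∈ S := hS htsI
    -- not on the side
    have hxs_lt : ‖xs - c‖ ^ 2 < P ts := by
      refine lt_of_le_of_ne hxs fun h => ?_
      have h1 := hside ts htsI xs h
      have h2 : 0 ≤ θ * (ts - t_b) := mul_nonneg hθ.le (by linarith)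
      simp [hw] at hXpos
      linarith
    -- spatial local maximum at `xs`
    set W : E → ℝ := fun x => φ ts x - g ts x - θ * (ts - t_b) with hW
    have hW2 : ContDiffOn ℝ 2 W U :=
      (((hφ2 ts htsI).contDiffOn).sub (hg.contDiffOn ts htsS)).sub contDiffOn_const
    have hWmax : IsLocalMax W xs := by
      have hV : {x : E | ‖x - c‖ ^ 2 < P ts} ∈ 𝓝 xs :=
        (isOpen_lt ((continuous_id.sub continuous_const).norm.pow 2) continuous_const).mem_nhds
          hxs_lt
      filter_upwards [hV] with x hx
      exact hXmax (hKmem htsI hx.le)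
    have hDW : fderiv ℝ W xs = 0 := IsLocalMax.fderiv_eq_zero hWmax
    have hΔW : (Δ W) xs ≤ 0 := laplacian_nonpos_of_isLocalMax_of_contDiffOn hU hxsU hW2 hWmax
    -- consequences: `Dφ = Dg` and `Δφ − Δg ≤ 0` at `(ts, xs)`
    have hφc : ContDiffAt ℝ 2 (φ ts) xs := (hφ2 ts htsI).contDiffAt
    have hgc : ContDiffAt ℝ 2 (g ts) xs := (hg.contDiffOn ts htsS).contDiffAt (hU.mem_nhds hxsU)
    have hvd : DifferentiableAt ℝ (φ ts) xs := hφc.differentiableAt (by norm_num)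
    have hgd : DifferentiableAt ℝ (g ts) xs := hgc.differentiableAt (by norm_num)
    have hDeq : fderiv ℝ (φ ts) xs = fderiv ℝ (g ts) xs := by
      have h1 : fderiv ℝ W xs = fderiv ℝ (φ ts) xs - fderiv ℝ (g ts) xs := by
        rw [hW, fderiv_sub_const, fderiv_fun_sub hvd hgd]
      rw [h1] at hDW
      exact sub_eq_zero.1 hDW
    have hΔeq : (Δ W) xs = (Δ (φ ts)) xs - (Δ (g ts)) xs := by
      have h1 : W = (φ ts - g ts) - fun _ => θ * (ts - t_b) := by funext x; simp [hW]
      have hc1 : ContDiffAt ℝ 2 (φ ts - g ts) xs := hφc.sub hgc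
      rw [h1, hc1.laplacian_sub contDiffAt_const, hφc.laplacian_sub hgc, laplacian_const]
      simp
    -- continuity of `∇g(·, xs)`, `Δg(·, xs)` on `(t_b, t_T]`
    have hIocS : Ioc t_b t_T ⊆ S := Ioc_subset_Icc_self.trans hS
    have hgD_c : ContinuousOn (fun τ => fderiv ℝ (g τ) xs) (Ioc t_b t_T) :=
      continuousOn_time_slice (F := fun p : ℝ × E => fderiv ℝ (g p.1) p.2)
        hg.continuousOn_fderiv hxsU hIocS
    have hgΔ_c : ContinuousOn (fun τ => (Δ (g τ)) xs) (Ioc t_b t_T) :=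
      continuousOn_time_slice (F := fun p : ℝ × E => (Δ (g p.1)) p.2)
        hg.continuousOn_laplacian hxsU hIocS
    -- the continuous majorant `J` of the integrand, negative near `ts`
    set J : ℝ → ℝ := fun τ => (Δ (φ τ)) xs - A * ‖fderiv ℝ (φ τ) xs‖ - (Δ (g τ)) xs +
      A * ‖fderiv ℝ (g τ) xs‖ - θ with hJ
    have hJc : ContinuousOn J (Ioc t_b t_T) := by
      refine (((((hφΔ_c xs).mono Ioc_subset_Icc_self).sub
        (continuousOn_const.mul ((hφD_c xs).mono Ioc_subset_Icc_self).norm)).sub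
        hgΔ_c).add (continuousOn_const.mul hgD_c.norm)).sub continuousOn_const
    have hJts : J ts ≤ -θ := by
      simp only [hJ, hDeq]
      linarith [hΔW, hΔeq]
    -- (a) `J < -θ/2` near `ts` within `(t_b, t_T]`
    obtain ⟨δ₁, hδ₁, hJneg⟩ : ∃ δ₁ > 0, ∀ τ ∈ Ioc t_b t_T, dist τ ts < δ₁ → J τ < -θ / 2 := by
      have hev : ∀ᶠ τ in 𝓝[Ioc t_b t_T] ts, J τ < -θ / 2 :=
        (hJc ts htsIoc).eventually (gt_mem_nhds (by linarith))
      rw [eventually_nhdsWithin_iff, Metric.eventually_nhds_iff] at hev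
      obtain ⟨δ₁, hδ₁, h⟩ := hev
      exact ⟨δ₁, hδ₁, fun τ hτ hd => h hd hτ⟩
    -- (b) `xs` stays inside the paraboloid for nearby times
    obtain ⟨δ₂, hδ₂, hins⟩ : ∃ δ₂ > 0, ∀ τ, dist τ ts < δ₂ → ‖xs - c‖ ^ 2 < P τ := by
      have hev : ∀ᶠ τ in 𝓝 ts, ‖xs - c‖ ^ 2 < P τ :=
        hPc.continuousAt.eventually (lt_mem_nhds hxs_lt)
      rw [Metric.eventually_nhds_iff] at hev
      exact hev
    -- the earlier time `t₁`
    set δ : ℝ := min (min δ₁ δ₂) (ts - t_b) / 2 with hδ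
    have hδpos : 0 < δ := by
      have : 0 < min (min δ₁ δ₂) (ts - t_b) := lt_min (lt_min hδ₁ hδ₂) (by linarith)
      rw [hδ]; linarith
    have hδ1 : δ < δ₁ := by
      have : min (min δ₁ δ₂) (ts - t_b) ≤ δ₁ := (min_le_left _ _).trans (min_le_left _ _)
      rw [hδ]; linarith
    have hδ2 : δ < δ₂ := by
      have : min (min δ₁ δ₂) (ts - t_b) ≤ δ₂ := (min_le_left _ _).trans (min_le_right _ _)
      rw [hδ]; linarith
    have hδ3 : δ < ts - t_b := by
      have : min (min δ₁ δ₂) (ts - t_b) ≤ ts - t_b := min_le_right _ _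
      rw [hδ]; linarith
    set t₁ : ℝ := ts - δ with ht₁
    have ht₁_gt : t_b < t₁ := by rw [ht₁]; linarith
    have ht₁_lt : t₁ < ts := by rw [ht₁]; linarith
    have hnear : ∀ τ ∈ Icc t₁ ts, dist τ ts < δ₁ ∧ dist τ ts < δ₂ ∧ τ ∈ Ioc t_b t_T := by
      intro τ hτ
      have hd : dist τ ts ≤ δ := by
        rw [Real.dist_eq, abs_sub_comm, abs_of_nonneg (by linarith [hτ.2])]
        linarith [hτ.1]
      exact ⟨hd.trans_lt hδ1, hd.trans_lt hδ2, ⟨by linarith [hτ.1], hτ.2.trans htsI.2⟩⟩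
    -- `(t₁, xs) ∈ K`, so `w (t₁, xs) ≤ w (ts, xs)`
    have ht₁I : t₁ ∈ Icc t_b t_T := ⟨ht₁_gt.le, ht₁_lt.le.trans htsI.2⟩
    have ht₁K : (t₁, xs) ∈ K := by
      refine hKmem ht₁I ?_
      exact (hins t₁ (hnear t₁ ⟨le_rfl, ht₁_lt.le⟩).2.1).le
    have hwle : w (t₁, xs) ≤ w (ts, xs) := hXmax ht₁K
    -- the integral identity for `w (ts, xs) - w (t₁, xs)`
    set I : ℝ → ℝ := fun τ => φt τ xs - ((Δ (g τ)) xs - fderiv ℝ (g τ) xs (a τ xs)) - θ with hI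
    have hsubI : uIcc t₁ ts ⊆ Icc t_b t_T := by
      rw [uIcc_of_le ht₁_lt.le]; exact Icc_subset_Icc ht₁_gt.le htsI.2
    have hi1 : IntervalIntegrable (fun τ => φt τ xs) volume t₁ ts :=
      ((hφt_c xs).mono hsubI).intervalIntegrable
    have hvFTC : φ ts xs - φ t₁ xs = ∫ τ in t₁..ts, φt τ xs :=
      (intervalIntegral.integral_eq_sub_of_hasDerivAt (fun τ hτ => hφt xs τ (hsubI hτ)) hi1).symm
    have hIccS : Icc t₁ ts ⊆ S := (Icc_subset_Icc ht₁_gt.le htsI.2).trans hS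
    have hgFTC := hg.integral_eq xs hxsU t₁ (hS ht₁I) ts htsS ht₁_lt.le
    have hi2 : IntervalIntegrable (fun τ => (Δ (g τ)) xs - fderiv ℝ (g τ) xs (a τ xs))
        volume t₁ ts := hg.intervalIntegrable hxsU ht₁_lt.le hIccS
    have hi3 : IntervalIntegrable (fun _ : ℝ => θ) volume t₁ ts := intervalIntegrable_const
    have hdiff : w (ts, xs) - w (t₁, xs) = ∫ τ in t₁..ts, I τ := by
      have h1 : ∫ τ in t₁..ts, I τ =
          (∫ τ in t₁..ts, φt τ xs) -
            (∫ τ in t₁..ts, ((Δ (g τ)) xs - fderiv ℝ (g τ) xs (a τ xs))) -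
            ∫ τ in t₁..ts, θ := by
        rw [hI, intervalIntegral.integral_sub (hi1.sub hi2) hi3,
          intervalIntegral.integral_sub hi1 hi2]
      rw [h1, ← hvFTC, ← hgFTC, intervalIntegral.integral_const, smul_eq_mul]
      simp only [hw]
      ring
    -- pointwise: `I ≤ J < -θ/2` on `[t₁, ts]`
    have hIle : ∀ τ ∈ Icc t₁ ts, I τ ≤ -θ / 2 := by
      intro τ hτ
      obtain ⟨hd1, hd2, hτI⟩ := hnear τ hτ
      have h1 : φt τ xs ≤ (Δ (φ τ)) xs - A * ‖fderiv ℝ (φ τ) xs‖ :=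
        hφ_ineq τ hτI xs (hins τ hd2)
      have h2 : fderiv ℝ (g τ) xs (a τ xs) ≤ A * ‖fderiv ℝ (g τ) xs‖ := by
        calc fderiv ℝ (g τ) xs (a τ xs) ≤ ‖fderiv ℝ (g τ) xs (a τ xs)‖ := Real.le_norm_self _
          _ ≤ ‖fderiv ℝ (g τ) xs‖ * ‖a τ xs‖ := ContinuousLinearMap.le_opNorm _ _
          _ ≤ ‖fderiv ℝ (g τ) xs‖ * A :=
              mul_le_mul_of_nonneg_left
                (hg.norm_drift_le τ (hS (Ioc_subset_Icc_self hτI)) xs hxsU) (norm_nonneg _)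
          _ = A * ‖fderiv ℝ (g τ) xs‖ := mul_comm _ _
      have h3 : I τ ≤ J τ := by
        simp only [hI, hJ]
        linarith
      exact h3.trans (hJneg τ hτI hd1).le
    have hIint : IntervalIntegrable I volume t₁ ts := (hi1.sub hi2).sub hi3
    have hint_le : ∫ τ in t₁..ts, I τ ≤ ∫ _ in t₁..ts, (-θ / 2 : ℝ) :=
      intervalIntegral.integral_mono_on ht₁_lt.le hIint intervalIntegrable_const hIle
    have hneg : ∫ τ in t₁..ts, I τ < 0 := by
      refine hint_le.trans_lt ?_
      rw [intervalIntegral.integral_const, smul_eq_mul]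
      nlinarith
    -- contradiction with maximality
    linarith [hdiff, hneg, hwle]
  -- `θ → 0`
  intro t ht x hx
  by_contra hcon
  push Not at hcon
  set d : ℝ := φ t x - g t x with hd
  have hdpos : 0 < d := by rw [hd]; linarith
  have htT : t_b ≤ t_T := ht.1.trans ht.2
  have h := main (d / (2 * (t_T - t_b) + 2)) (by positivity) (t, x) (hKmem ht hx)
  simp only at h
  have h1 : d / (2 * (t_T - t_b) + 2) * (t - t_b) ≤ d / (2 * (t_T - t_b) + 2) * (t_T - t_b) :=
    mul_le_mul_of_nonneg_left (by linarith [ht.2]) (by positivity)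
  have h2 : d / (2 * (t_T - t_b) + 2) * (t_T - t_b) < d := by
    rw [div_mul_eq_mul_div, div_lt_iff₀ (by linarith)]
    nlinarith
  linarith

end IsDriftHeatSolutionOn

end Literature.Analysis.FluidPDE

end
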